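import Summits.CriticalPhenomena.PercolationContinuityZ3.Theorems.PercNearOneGluingNoHeavyLowerTailSahiE3Cylinder
import Mathlib.Tactic.Linarith
import Mathlib.Tactic.Ring
import Mathlib.Tactic.Positivity
import HarnessLib

/-!
# `NoHeavyLowerTail` (stmt-CriticalPhenomena-4575) — Sahi's `E₃ ≥ 0` on the weighted cube for THREE HITTING EVENTS
# (co-principal up-sets `{S : S ∩ X ≠ ∅}` of arbitrary `A, B, C`), every product measure, every dimension

Support file (prover prim-sahi-p2 gen 17; `--supports stmt-CriticalPhenomena-4575`).  No named facts, no sorries, no definitions.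

Context.  Sahi's third functional `E₃(f,g,h) = 2E[fgh] + Ef·Eg·Eh − Ef·E[gh] − Eg·E[fh] − Eh·E[fg]` is conjectured nonnegative for
monotone nonnegative `f, g, h` under product (indeed FKG) measures [Sahi 2008, Conj. 5]; open even on `{0,1}^k`.  Proved classes
(tree): one slot a CYLINDER `1[a ⊆ S]` (`sahiE3_cylinder_nonneg`), product of two slots a cylinder (`sahiE3_nonneg_of_mul_eq_cylinder`),
conditional-Harris, containment, chains, dimension `≤ 5` for all up-sets (typer), Lieb–Sahi's rectangles.

This file adds the class of three HITTING events: for arbitrary finite sets `A, B, C` and the weighted cube on `D` with coordinate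
probabilities `p ∈ [0,1]^ι`, the up-sets `U_X = {S : S ∩ X ≠ ∅}` (complements of the principal DOWN-sets `{S : S ∩ X = ∅}`; the
conditional measure given `U_X` is NOT positively associated, so the class is not inside conditional-Harris) satisfy
`E₃(1_{U_A}, 1_{U_B}, 1_{U_C}) ≥ 0` (**`sahiE3_hitting_nonneg`**).  Equivalently (complement identity `E₃(1−f,1−g,1−h) =
Cov(f,g)+Cov(f,h)+Cov(g,h) − E₃(f,g,h)`): for the three down-cylinders `V_X = 1[S ∩ X = ∅]`,
`E₃(V_A,V_B,V_C) ≤ Cov(V_A,V_B) + Cov(V_A,V_C) + Cov(V_B,V_C)` (**`sahiE3_avoid_le_cov`**).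

Proof.  `E[∏ V_X] = q(⋃ X)` with `q(X) = ∏_{i ∈ D ∩ X} (1 − p_i)` (`ED_avoid`), and `q` is multiplicative over the seven Venn regions of
`(A,B,C)`; writing `a, b, c` for the `q`-values of the private regions and `x, y, z, w` for those of `A∩B∖C, A∩C∖B, B∩C∖A, A∩B∩C`,
`E₃(1_{U_A},1_{U_B},1_{U_C}) = xyzw·[ab(1−c)(1−xw) + a(1−b)c(1−yw) + (1−a)bc(1−zw) + abc((1−w) + w(1−x)(1−y)(1−z) + w(1−w)xyz)]`
(`sahiE3_hitting_poly`), manifestly nonnegative on `[0,1]^7` — the bracket is multi-affine in the private parts `a, b, c` with nonnegative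
vertex values.

Use (percolation, memo `run/shared/lean/prim/prim-sahi/prim-sahi-p2/gen17/`): in the root decomposition of the increasing star
`E₃ = T1 + T2 + T3` (gen 16, PROOF-E3 §26e) the cube term `T2 = E₃^π(m_a,m_b,m_c)` is, by trilinearity of `E₃` over three independent
copies of `G − s`, a mixture of `E₃` of three hitting indicators of the cluster traces on the root neighbourhood, hence `≥ 0` for EVERY
root degree by this file (previously only degree `≤ 5`); the mixture-over-quotients conjecture `(MQ): T2 + T3 ≥ 0` itself is false (gen 17).
-/

noncomputable section

namespace Summit.CriticalPhenomena.PercolationContinuityZ3.Theorems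

namespace SahiHitting

open Finset Literature.Probability.Percolation Literature.Probability.Percolation.DecisionTree

variable {ι : Type*} [DecidableEq ι]

/-- The avoidance product `q(X) = ∏_{i ∈ D} (1 − p_i if i ∈ X else 1)`: the probability that the random subset of `D` misses `X`. -/
theorem ED_avoid (D : Finset ι) (p : ι → ℝ) (X : Finset ι) :
    ED D p (fun S => if Disjoint S X then (1 : ℝ) else 0) = ∏ i ∈ D, (if i ∈ X then 1 - p i else 1) := by
  induction D using Finset.induction_on with
  | empty =>
    rw [ED_empty, Finset.prod_empty, if_pos (Finset.disjoint_empty_left X)]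
  | @insert e D' he ih =>
    rw [ED_insert p he, Finset.prod_insert he]
    by_cases heX : e ∈ X
    · -- through `e ∈ X` the configuration meets `X`: that section vanishes
      have h0 : ED D' p (fun S => if Disjoint (insert e S) X then (1 : ℝ) else 0) = ED D' p (fun _ => (0 : ℝ)) := by
        refine ED_congr_sub _ _ fun S _ => ?_
        have : ¬ Disjoint (insert e S) X := fun h => (Finset.disjoint_left.1 h (Finset.mem_insert_self e S)) heX
        rw [if_neg this]
      have h0' : ED D' p (fun _ => (0 : ℝ)) = 0 := by
        have := ED_mul_left D' p 0 (fun _ => (1 : ℝ))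
        simpa using this
      rw [h0, h0', ih, if_pos heX]
      ring
    · have h1 : ED D' p (fun S => if Disjoint (insert e S) X then (1 : ℝ) else 0) =
          ED D' p (fun S => if Disjoint S X then (1 : ℝ) else 0) := by
        refine ED_congr_sub _ _ fun S _ => ?_
        have hiff : Disjoint (insert e S) X ↔ Disjoint S X := by
          rw [Finset.disjoint_insert_left]
          exact ⟨fun h => h.2, fun h => ⟨heX, h⟩⟩
        simp only [hiff]
      rw [h1, ih, if_neg heX]
      ring

/-- `ED` of a difference. -/
theorem ED_sub' (D : Finset ι) (p : ι → ℝ) (φ ψ : Finset ι → ℝ) :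
    ED D p (fun S => φ S - ψ S) = ED D p φ - ED D p ψ := by
  unfold ED
  rw [← Finset.sum_sub_distrib]
  exact Finset.sum_congr rfl fun S _ => by ring

/-- The polynomial heart: with the seven Venn-region avoidance values in `[0,1]`, Sahi's `E₃` of the three hitting indicators is the
manifestly nonnegative expression below. [this work] -/
theorem sahiE3_hitting_poly {a b c x y z w : ℝ}
    (ha0 : 0 ≤ a) (ha1 : a ≤ 1) (hb0 : 0 ≤ b) (hb1 : b ≤ 1) (hc0 : 0 ≤ c) (hc1 : c ≤ 1)
    (hx0 : 0 ≤ x) (hx1 : x ≤ 1) (hy0 : 0 ≤ y) (hy1 : y ≤ 1) (hz0 : 0 ≤ z) (hz1 : z ≤ 1) (hw0 : 0 ≤ w) (hw1 : w ≤ 1) :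
    0 ≤ 2 * (1 - a*x*y*w - b*x*z*w - c*y*z*w + a*b*x*y*z*w + a*c*x*y*z*w + b*c*x*y*z*w - a*b*c*x*y*z*w)
        + (1 - a*x*y*w) * (1 - b*x*z*w) * (1 - c*y*z*w)
        - (1 - a*x*y*w) * (1 - b*x*z*w - c*y*z*w + b*c*x*y*z*w)
        - (1 - b*x*z*w) * (1 - a*x*y*w - c*y*z*w + a*c*x*y*z*w)
        - (1 - c*y*z*w) * (1 - a*x*y*w - b*x*z*w + a*b*x*y*z*w) := by
  have key : 2 * (1 - a*x*y*w - b*x*z*w - c*y*z*w + a*b*x*y*z*w + a*c*x*y*z*w + b*c*x*y*z*w - a*b*c*x*y*z*w)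
        + (1 - a*x*y*w) * (1 - b*x*z*w) * (1 - c*y*z*w)
        - (1 - a*x*y*w) * (1 - b*x*z*w - c*y*z*w + b*c*x*y*z*w)
        - (1 - b*x*z*w) * (1 - a*x*y*w - c*y*z*w + a*c*x*y*z*w)
        - (1 - c*y*z*w) * (1 - a*x*y*w - b*x*z*w + a*b*x*y*z*w)
      = x*y*z*w * (a*b*(1-c)*(1-x*w) + a*(1-b)*c*(1-y*w) + (1-a)*b*c*(1-z*w)
          + a*b*c*((1-w) + w*((1-x)*(1-y)*(1-z)) + w*(1-w)*(x*y*z))) := by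
    ring
  rw [key]
  have h1 : 0 ≤ 1 - x*w := by nlinarith
  have h2 : 0 ≤ 1 - y*w := by nlinarith
  have h3 : 0 ≤ 1 - z*w := by nlinarith
  have hA : 0 ≤ a*b*(1-c)*(1-x*w) := by
    have := mul_nonneg (mul_nonneg (mul_nonneg ha0 hb0) (sub_nonneg.2 hc1)) h1; linarith
  have hB : 0 ≤ a*(1-b)*c*(1-y*w) := by
    have := mul_nonneg (mul_nonneg (mul_nonneg ha0 (sub_nonneg.2 hb1)) hc0) h2; linarith
  have hC : 0 ≤ (1-a)*b*c*(1-z*w) := by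
    have := mul_nonneg (mul_nonneg (mul_nonneg (sub_nonneg.2 ha1) hb0) hc0) h3; linarith
  have hV : 0 ≤ (1-w) + w*((1-x)*(1-y)*(1-z)) + w*(1-w)*(x*y*z) := by
    have t1 : 0 ≤ w*((1-x)*(1-y)*(1-z)) :=
      mul_nonneg hw0 (mul_nonneg (mul_nonneg (sub_nonneg.2 hx1) (sub_nonneg.2 hy1)) (sub_nonneg.2 hz1))
    have t2 : 0 ≤ w*(1-w)*(x*y*z) :=
      mul_nonneg (mul_nonneg hw0 (sub_nonneg.2 hw1)) (mul_nonneg (mul_nonneg hx0 hy0) hz0)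
    linarith [sub_nonneg.2 hw1]
  have hD : 0 ≤ a*b*c*((1-w) + w*((1-x)*(1-y)*(1-z)) + w*(1-w)*(x*y*z)) :=
    mul_nonneg (mul_nonneg (mul_nonneg ha0 hb0) hc0) hV
  exact mul_nonneg (mul_nonneg (mul_nonneg (mul_nonneg hx0 hy0) hz0) hw0) (by linarith)

omit [DecidableEq ι] in
/-- The avoidance product on `D` of a predicate is nonnegative. -/
private theorem prod_ite_nonneg (D : Finset ι) {p : ι → ℝ} (hp1 : ∀ i, p i ≤ 1)
    (P : ι → Prop) [DecidablePred P] : 0 ≤ ∏ i ∈ D, (if P i then 1 - p i else (1 : ℝ)) :=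
  Finset.prod_nonneg fun i _ => by split_ifs <;> [exact sub_nonneg.2 (hp1 i); exact zero_le_one]

omit [DecidableEq ι] in
/-- The avoidance product on `D` of a predicate is at most one. -/
private theorem prod_ite_le_one (D : Finset ι) {p : ι → ℝ} (hp0 : ∀ i, 0 ≤ p i) (hp1 : ∀ i, p i ≤ 1)
    (P : ι → Prop) [DecidablePred P] : ∏ i ∈ D, (if P i then 1 - p i else (1 : ℝ)) ≤ 1 :=
  Finset.prod_le_one (fun i _ => by split_ifs <;> [exact sub_nonneg.2 (hp1 i); exact zero_le_one])
    fun i _ => by split_ifs <;> [linarith [hp0 i]; exact le_rfl]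

/-- **Sahi's `E₃ ≥ 0` for three down-cylinders, as the upper bound by the pairwise covariances** (`V_X = 1[S ∩ X = ∅]`):
`2E[V_AV_BV_C] + EV_A·EV_B·EV_C − Σ EV_A·E[V_BV_C] ≤ Σ_{pairs} (E[V_XV_Y] − EV_X·EV_Y)`, written with `E[∏ V] = q(⋃)`.
[this work] -/
theorem sahiE3_avoid_le_cov (D : Finset ι) {p : ι → ℝ} (hp0 : ∀ i, 0 ≤ p i) (hp1 : ∀ i, p i ≤ 1)
    (A B C : Finset ι) :
    let q : Finset ι → ℝ := fun X => ∏ i ∈ D, (if i ∈ X then 1 - p i else 1)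
    2 * q (A ∪ B ∪ C) + q A * q B * q C - q A * q (B ∪ C) - q B * q (A ∪ C) - q C * q (A ∪ B)
      ≤ (q (A ∪ B) - q A * q B) + (q (A ∪ C) - q A * q C) + (q (B ∪ C) - q B * q C) := by
  intro q
  -- the seven Venn regions
  set a : ℝ := ∏ i ∈ D, (if i ∈ A ∧ i ∉ B ∧ i ∉ C then 1 - p i else 1) with ha
  set b : ℝ := ∏ i ∈ D, (if i ∉ A ∧ i ∈ B ∧ i ∉ C then 1 - p i else 1) with hb
  set c : ℝ := ∏ i ∈ D, (if i ∉ A ∧ i ∉ B ∧ i ∈ C then 1 - p i else 1) with hc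
  set x : ℝ := ∏ i ∈ D, (if i ∈ A ∧ i ∈ B ∧ i ∉ C then 1 - p i else 1) with hx
  set y : ℝ := ∏ i ∈ D, (if i ∈ A ∧ i ∉ B ∧ i ∈ C then 1 - p i else 1) with hy
  set z : ℝ := ∏ i ∈ D, (if i ∉ A ∧ i ∈ B ∧ i ∈ C then 1 - p i else 1) with hz
  set w : ℝ := ∏ i ∈ D, (if i ∈ A ∧ i ∈ B ∧ i ∈ C then 1 - p i else 1) with hw
  -- factorisations of the seven unions over the regions (coordinatewise case analysis)
  have fA : q A = a * x * y * w := by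
    simp only [q, ha, hx, hy, hw, ← Finset.prod_mul_distrib]
    refine Finset.prod_congr rfl fun i _ => ?_
    by_cases h1 : i ∈ A <;> by_cases h2 : i ∈ B <;> by_cases h3 : i ∈ C <;> simp [h1, h2, h3]
  have fB : q B = b * x * z * w := by
    simp only [q, hb, hx, hz, hw, ← Finset.prod_mul_distrib]
    refine Finset.prod_congr rfl fun i _ => ?_
    by_cases h1 : i ∈ A <;> by_cases h2 : i ∈ B <;> by_cases h3 : i ∈ C <;> simp [h1, h2, h3]
  have fC : q C = c * y * z * w := by
    simp only [q, hc, hy, hz, hw, ← Finset.prod_mul_distrib]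
    refine Finset.prod_congr rfl fun i _ => ?_
    by_cases h1 : i ∈ A <;> by_cases h2 : i ∈ B <;> by_cases h3 : i ∈ C <;> simp [h1, h2, h3]
  have fAB : q (A ∪ B) = a * b * x * y * z * w := by
    simp only [q, ha, hb, hx, hy, hz, hw, ← Finset.prod_mul_distrib]
    refine Finset.prod_congr rfl fun i _ => ?_
    by_cases h1 : i ∈ A <;> by_cases h2 : i ∈ B <;> by_cases h3 : i ∈ C <;> simp [h1, h2, h3]
  have fAC : q (A ∪ C) = a * c * x * y * z * w := by
    simp only [q, ha, hc, hx, hy, hz, hw, ← Finset.prod_mul_distrib]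
    refine Finset.prod_congr rfl fun i _ => ?_
    by_cases h1 : i ∈ A <;> by_cases h2 : i ∈ B <;> by_cases h3 : i ∈ C <;> simp [h1, h2, h3]
  have fBC : q (B ∪ C) = b * c * x * y * z * w := by
    simp only [q, hb, hc, hx, hy, hz, hw, ← Finset.prod_mul_distrib]
    refine Finset.prod_congr rfl fun i _ => ?_
    by_cases h1 : i ∈ A <;> by_cases h2 : i ∈ B <;> by_cases h3 : i ∈ C <;> simp [h1, h2, h3]
  have fABC : q (A ∪ B ∪ C) = a * b * c * x * y * z * w := by
    simp only [q, ha, hb, hc, hx, hy, hz, hw, ← Finset.prod_mul_distrib]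
    refine Finset.prod_congr rfl fun i _ => ?_
    by_cases h1 : i ∈ A <;> by_cases h2 : i ∈ B <;> by_cases h3 : i ∈ C <;> simp [h1, h2, h3]
  rw [fA, fB, fC, fAB, fAC, fBC, fABC]
  have H := sahiE3_hitting_poly
    (prod_ite_nonneg D hp1 _) (prod_ite_le_one D hp0 hp1 _) (prod_ite_nonneg D hp1 _) (prod_ite_le_one D hp0 hp1 _)
    (prod_ite_nonneg D hp1 _) (prod_ite_le_one D hp0 hp1 _) (prod_ite_nonneg D hp1 _) (prod_ite_le_one D hp0 hp1 _)
    (prod_ite_nonneg D hp1 _) (prod_ite_le_one D hp0 hp1 _) (prod_ite_nonneg D hp1 _) (prod_ite_le_one D hp0 hp1 _)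
    (prod_ite_nonneg D hp1 _) (prod_ite_le_one D hp0 hp1 _)
    (a := a) (b := b) (c := c) (x := x) (y := y) (z := z) (w := w)
  nlinarith [H]

/-- **Sahi's `E₃ ≥ 0` for three HITTING events** `U_X = {S : S ∩ X ≠ ∅}` (`X = A, B, C` arbitrary finite sets) on the weighted cube
`D` with coordinate probabilities `p ∈ [0,1]`:
`0 ≤ 2E[1_{U_A}1_{U_B}1_{U_C}] + E1_{U_A}·E1_{U_B}·E1_{U_C} − E1_{U_A}·E[1_{U_B}1_{U_C}] − E1_{U_B}·E[1_{U_A}1_{U_C}] − E1_{U_C}·E[1_{U_A}1_{U_B}]`.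
[this work] -/
theorem sahiE3_hitting_nonneg (D : Finset ι) {p : ι → ℝ} (hp0 : ∀ i, 0 ≤ p i) (hp1 : ∀ i, p i ≤ 1) (A B C : Finset ι) :
    let u : Finset ι → Finset ι → ℝ := fun X S => if Disjoint S X then 0 else 1
    0 ≤ 2 * ED D p (fun S => u A S * u B S * u C S) + ED D p (u A) * ED D p (u B) * ED D p (u C)
        - ED D p (u A) * ED D p (fun S => u B S * u C S) - ED D p (u B) * ED D p (fun S => u A S * u C S)
        - ED D p (u C) * ED D p (fun S => u A S * u B S) := by
  intro u
  -- avoidance indicators and their products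
  set v : Finset ι → Finset ι → ℝ := fun X S => if Disjoint S X then 1 else 0 with hv
  have hvmul : ∀ X Y S, v X S * v Y S = v (X ∪ Y) S := by
    intro X Y S
    simp only [hv]
    by_cases h1 : Disjoint S X <;> by_cases h2 : Disjoint S Y <;>
      simp [h1, h2, Finset.disjoint_union_right]
  have huv : ∀ X S, u X S = 1 - v X S := by
    intro X S; simp only [hv, u]; split_ifs <;> norm_num
  set q : Finset ι → ℝ := fun X => ∏ i ∈ D, (if i ∈ X then 1 - p i else 1) with hq
  have Ev : ∀ X, ED D p (v X) = q X := fun X => ED_avoid D p X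
  -- one hitting indicator
  have E1 : ∀ X, ED D p (u X) = 1 - q X := by
    intro X
    have : u X = fun S => (1 : ℝ) - v X S := funext fun S => huv X S
    rw [this, ED_sub', ED_one, Ev]
  -- two
  have E2 : ∀ X Y, ED D p (fun S => u X S * u Y S) = 1 - q X - q Y + q (X ∪ Y) := by
    intro X Y
    have : (fun S => u X S * u Y S) = fun S => ((1 : ℝ) - v X S) - (v Y S - v (X ∪ Y) S) := by
      funext S; rw [huv, huv, ← hvmul]; ring
    rw [this, ED_sub', ED_sub', ED_sub', ED_one, Ev, Ev, Ev]; ring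
  -- three
  have E3 : ED D p (fun S => u A S * u B S * u C S) =
      1 - q A - q B - q C + q (A ∪ B) + q (A ∪ C) + q (B ∪ C) - q (A ∪ B ∪ C) := by
    have : (fun S => u A S * u B S * u C S) = fun S =>
        ((((1 : ℝ) - v A S) - (v B S - v (A ∪ B) S)) - ((v C S - v (A ∪ C) S) - (v (B ∪ C) S - v (A ∪ B ∪ C) S))) := by
      funext S
      rw [huv, huv, huv, ← hvmul A B, ← hvmul A C, ← hvmul B C, ← hvmul (A ∪ B) C, ← hvmul A B]; ring
    rw [this, ED_sub', ED_sub', ED_sub', ED_sub', ED_sub', ED_sub', ED_sub', ED_one, Ev, Ev, Ev, Ev, Ev, Ev, Ev]; ring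
  rw [E3, E1, E1, E1, E2, E2, E2]
  have H := sahiE3_avoid_le_cov D hp0 hp1 A B C
  simp only [] at H
  nlinarith [H]

end SahiHitting

end Summit.CriticalPhenomena.PercolationContinuityZ3.Theorems
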